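import Literature.Analysis.FluidPDE.ElgindiPolarSingularEstimate
import Literature.Analysis.FluidPDE.ElgindiPolarRadialCommutation
import HarnessLib

/-!
# Step 3 of Elgindi's weighted elliptic estimate: radial derivatives
([Elgindi2021] §7.3, Proposition 7.7, Step 3, display (7.4))

Topic `Literature/Analysis/FluidPDE`. Proof file (everything proved, no definitions, no named
facts) on the proof path of the named fact
`Literature.Analysis.FluidPDE.Elgindi.ElgindiGhoulMasmoudi2021_stabilityCore`
(`ElgindiStabilityDecomposition.lean`). T. M. Elgindi, Ann. of Math. 194 (2021) =
arXiv:1904.04795, §7.3, proof of Proposition 7.7, Step 3 (p. 22 of the held text):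

> "Consequently, `L(D_R^kΨ) = D_R^kF` for `k = 0, 1, 2`. Thus, using Steps 1 and 2 (in particular,
> (7.3)) we have:
> `α²|R²∂_{RR}(D_R)^kΨ w/sin(2θ)^{η/2}|_{L²} + |∂_θθ(D_R)^kΨ w/sin(2θ)^{η/2}|_{L²} ≤ C₁|(D_R)^kF w/sin(2θ)^{η/2}|_{L²}` (7.4)
> for `k = 0, 1, 2`."

In the a-priori class of Steps 1–2 (`Ψ = cos θ·χ`, `χ` compactly supported inside `R > 0` with
`χ(R,0) = 0`, `F := L(Ψ)` orthogonal to `sin θcos²θ` on every slice) the class is stable under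
`D_R = R∂_R` (`ElgindiPolarRadialCommutation.lean`: `D_RΨ = cos θ·D_Rχ`, `L(D_RΨ) = D_R L(Ψ)` on the
strip, and `L(D_RΨ) ⊥ sin θcos²θ`), so Steps 1 and 2 apply verbatim to `D_RΨ` (`χ ∈ C⁴`): `polar_weighted_apriori_estimate_Dz`,
`polar_singular_apriori_estimate_Dz` (right-hand sides `∫∫ w²(D_RF)²`, `∫∫ w²u(D_RF)²`), and by induction
to `D_R^jΨ` for every `j` (`χ ∈ C^{3+j}`; `iterate_Dz_congr` of `ElgindiStripCalculus.lean` transports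
the commutation): `polar_weighted_apriori_estimate_iterate`, `polar_singular_apriori_estimate_iterate`.
-/

noncomputable section

open MeasureTheory Set Real Filter Function
open _root_.Topology

namespace Literature.Analysis.FluidPDE

namespace Elgindi

section stepThree

variable {α : ℝ} (hα : 0 < α) (hα4 : α ≤ 1 / 4) {χ : ℝ → ℝ → ℝ}
  (hs : HasCompactSupport (uncurry χ)) (hpos : ∀ p ∈ tsupport (uncurry χ), 0 < p.1)
  (hχ0 : ∀ R, χ R 0 = 0) {Ψ : ℝ → ℝ → ℝ} (hΨ : Ψ = fun R θ => Real.cos θ * χ R θ)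
  (horth : ∀ R, 0 < R → ∫ θ in Ioo 0 (π / 2), ellipticOp α Ψ R θ * kernelK θ = 0)

include hα hα4 hs hpos hχ0 hΨ horth

/-- **Step 1 for `D_RΨ`** (`χ ∈ C⁴`): the eight conclusions of `polar_weighted_apriori_estimate` for
`D_RΨ = cos θ·D_Rχ`, with right-hand side `L₁ = ∫∫ w²(D_R L(Ψ))²`.
[cite: Elgindi2021, §7.3 proof of Proposition 7.7, Step 3 (p. 22 of arXiv:1904.04795)] -/
theorem polar_weighted_apriori_estimate_Dz (hχ : ContDiff ℝ 4 (uncurry χ)) :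
    (∫ p in strip, radialWeight p.1 ^ 2 * dθ (Dz Ψ) p.1 p.2 ^ 2) ≤ ∫ p in strip, radialWeight p.1 ^ 2 * Dz (ellipticOp α Ψ) p.1 p.2 ^ 2 ∧
    (∫ p in strip, radialWeight p.1 ^ 2 * Dz Ψ p.1 p.2 ^ 2) ≤ (1 / 12) * ∫ p in strip, radialWeight p.1 ^ 2 * Dz (ellipticOp α Ψ) p.1 p.2 ^ 2 ∧
    (∫ p in strip, radialWeight p.1 ^ 2 * dθ (dθ (Dz Ψ)) p.1 p.2 ^ 2) ≤ 12 * ∫ p in strip, radialWeight p.1 ^ 2 * Dz (ellipticOp α Ψ) p.1 p.2 ^ 2 ∧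
    (∫ p in strip, radialWeight p.1 ^ 2 * dθ (Dz χ) p.1 p.2 ^ 2) ≤ 8 * ∫ p in strip, radialWeight p.1 ^ 2 * Dz (ellipticOp α Ψ) p.1 p.2 ^ 2 ∧
    α ^ 2 * (∫ p in strip, radialWeight p.1 ^ 2 * (p.1 * dz (Dz Ψ) p.1 p.2) ^ 2) ≤ ∫ p in strip, radialWeight p.1 ^ 2 * Dz (ellipticOp α Ψ) p.1 p.2 ^ 2 ∧
    α ^ 4 * (∫ p in strip, radialWeight p.1 ^ 2 * (p.1 ^ 2 * dz (dz (Dz Ψ)) p.1 p.2) ^ 2) ≤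
      372 * ∫ p in strip, radialWeight p.1 ^ 2 * Dz (ellipticOp α Ψ) p.1 p.2 ^ 2 ∧
    α ^ 2 * (∫ p in strip, radialWeight p.1 ^ 2 * (p.1 * dz (dθ (Dz Ψ)) p.1 p.2) ^ 2) ≤
      12 * ∫ p in strip, radialWeight p.1 ^ 2 * Dz (ellipticOp α Ψ) p.1 p.2 ^ 2 ∧
    (∫ p in strip, radialWeight p.1 ^ 2 * Dz χ p.1 p.2 ^ 2) ≤ 2 * ∫ p in strip, radialWeight p.1 ^ 2 * Dz (ellipticOp α Ψ) p.1 p.2 ^ 2 := by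
  have hχ3 : ContDiff ℝ 3 (uncurry χ) := hχ.of_le (by norm_num)
  have hχ1 : ContDiff ℝ 1 (uncurry χ) := hχ.of_le (by norm_num)
  have hΨ3 : ContDiff ℝ 3 (uncurry Ψ) := by rw [hΨ]; exact contDiff_cosProfile hχ3
  -- the class hypotheses for `D_Rχ`
  have hχ' : ContDiff ℝ 3 (uncurry (Dz χ)) := contDiff_Dz_of_contDiff (n := 3) hχ
  have hs' : HasCompactSupport (uncurry (Dz χ)) := hasCompactSupport_Dz hs
  have hpos' : ∀ p ∈ tsupport (uncurry (Dz χ)), 0 < p.1 := tsupport_Dz_pos hpos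
  have hχ0' : ∀ R, Dz χ R 0 = 0 := Dz_eq_zero_of_forall hχ0
  have hΨ' : Dz Ψ = fun R θ => Real.cos θ * Dz χ R θ := by rw [hΨ]; exact Dz_cosProfile hχ1
  have horth' := ellipticOp_Dz_orthogonal (α := α) hχ hs hΨ horth
  have h := polar_weighted_apriori_estimate hα hα4 hχ' hs' hpos' hχ0' hΨ' horth'
  -- replace `L(D_RΨ)` by `D_R L(Ψ)` on the strip
  have eL : ∫ p in strip, radialWeight p.1 ^ 2 * ellipticOp α (Dz Ψ) p.1 p.2 ^ 2 =
      ∫ p in strip, radialWeight p.1 ^ 2 * Dz (ellipticOp α Ψ) p.1 p.2 ^ 2 :=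
    setIntegral_congr_fun measurableSet_strip fun p hp => by rw [ellipticOp_Dz α hΨ3 hp]
  rw [eL] at h
  exact h

/-- **Step 2 / display (7.4) for `k = 1`** (`χ ∈ C⁴`): the eight conclusions of
`polar_singular_apriori_estimate` for `D_RΨ`, with right-hand side `∫∫ w²u(D_R L(Ψ))²`.
[cite: Elgindi2021, §7.3 proof of Proposition 7.7, Step 3, display (7.4) (p. 22 of arXiv:1904.04795)] -/
theorem polar_singular_apriori_estimate_Dz (hχ : ContDiff ℝ 4 (uncurry χ)) :
    (∫ p in strip, radialWeight p.1 ^ 2 * dθ (dθ (Dz Ψ)) p.1 p.2 ^ 2 * Real.sin (2 * p.2) ^ (-eta)) ≤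
        42000 * ∫ p in strip, radialWeight p.1 ^ 2 * Dz (ellipticOp α Ψ) p.1 p.2 ^ 2 * Real.sin (2 * p.2) ^ (-eta) ∧
    α ^ 2 * (∫ p in strip, p.1 ^ 2 * radialWeight p.1 ^ 2 * dz (dθ (Dz Ψ)) p.1 p.2 ^ 2 * Real.sin (2 * p.2) ^ (-eta)) ≤
        4200000 * ∫ p in strip, radialWeight p.1 ^ 2 * Dz (ellipticOp α Ψ) p.1 p.2 ^ 2 * Real.sin (2 * p.2) ^ (-eta) ∧
    (∫ p in strip, radialWeight p.1 ^ 2 * dθ (Dz χ) p.1 p.2 ^ 2 * Real.sin (2 * p.2) ^ (-eta)) ≤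
        21000 * ∫ p in strip, radialWeight p.1 ^ 2 * Dz (ellipticOp α Ψ) p.1 p.2 ^ 2 * Real.sin (2 * p.2) ^ (-eta) ∧
    α ^ 2 * (∫ p in strip, p.1 ^ 2 * radialWeight p.1 ^ 2 * dz (Dz Ψ) p.1 p.2 ^ 2 * Real.sin (2 * p.2) ^ (-eta)) ≤
        120 * ∫ p in strip, radialWeight p.1 ^ 2 * Dz (ellipticOp α Ψ) p.1 p.2 ^ 2 * Real.sin (2 * p.2) ^ (-eta) ∧
    (∫ p in strip, radialWeight p.1 ^ 2 * Dz Ψ p.1 p.2 ^ 2 * Real.sin (2 * p.2) ^ (-eta)) ≤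
        10 * ∫ p in strip, radialWeight p.1 ^ 2 * Dz (ellipticOp α Ψ) p.1 p.2 ^ 2 * Real.sin (2 * p.2) ^ (-eta) ∧
    (∫ p in strip, radialWeight p.1 ^ 2 * Dz χ p.1 p.2 ^ 2 * Real.sin (2 * p.2) ^ (-eta)) ≤
        4748 * ∫ p in strip, radialWeight p.1 ^ 2 * Dz (ellipticOp α Ψ) p.1 p.2 ^ 2 * Real.sin (2 * p.2) ^ (-eta) ∧
    (∫ p in strip, radialWeight p.1 ^ 2 * dθ (Dz Ψ) p.1 p.2 ^ 2 * Real.sin (2 * p.2) ^ (-eta)) ≤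
        6322 * ∫ p in strip, radialWeight p.1 ^ 2 * Dz (ellipticOp α Ψ) p.1 p.2 ^ 2 * Real.sin (2 * p.2) ^ (-eta) ∧
    α ^ 4 * (∫ p in strip, radialWeight p.1 ^ 2 * (p.1 ^ 2 * dz (dz (Dz Ψ)) p.1 p.2) ^ 2 * Real.sin (2 * p.2) ^ (-eta)) ≤
        440000 * ∫ p in strip, radialWeight p.1 ^ 2 * Dz (ellipticOp α Ψ) p.1 p.2 ^ 2 * Real.sin (2 * p.2) ^ (-eta) := by
  have hχ3 : ContDiff ℝ 3 (uncurry χ) := hχ.of_le (by norm_num)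
  have hχ1 : ContDiff ℝ 1 (uncurry χ) := hχ.of_le (by norm_num)
  have hΨ3 : ContDiff ℝ 3 (uncurry Ψ) := by rw [hΨ]; exact contDiff_cosProfile hχ3
  have hχ' : ContDiff ℝ 3 (uncurry (Dz χ)) := contDiff_Dz_of_contDiff (n := 3) hχ
  have hs' : HasCompactSupport (uncurry (Dz χ)) := hasCompactSupport_Dz hs
  have hpos' : ∀ p ∈ tsupport (uncurry (Dz χ)), 0 < p.1 := tsupport_Dz_pos hpos
  have hχ0' : ∀ R, Dz χ R 0 = 0 := Dz_eq_zero_of_forall hχ0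
  have hΨ' : Dz Ψ = fun R θ => Real.cos θ * Dz χ R θ := by rw [hΨ]; exact Dz_cosProfile hχ1
  have horth' := ellipticOp_Dz_orthogonal (α := α) hχ hs hΨ horth
  have h := polar_singular_apriori_estimate hα hα4 hχ' hs' hpos' hχ0' hΨ' horth'
  have eL : ∫ p in strip, radialWeight p.1 ^ 2 * ellipticOp α (Dz Ψ) p.1 p.2 ^ 2 * Real.sin (2 * p.2) ^ (-eta) =
      ∫ p in strip, radialWeight p.1 ^ 2 * Dz (ellipticOp α Ψ) p.1 p.2 ^ 2 * Real.sin (2 * p.2) ^ (-eta) :=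
    setIntegral_congr_fun measurableSet_strip fun p hp => by rw [ellipticOp_Dz α hΨ3 hp]
  rw [eL] at h
  exact h

end stepThree

/-! ### All radial orders -/

/-- **Step 1 for `D_R^jΨ`, all `j`** (`χ ∈ C^{3+j}`): the eight conclusions of
`polar_weighted_apriori_estimate` for `D_R^jΨ = cos θ·D_R^jχ`, right-hand side `∫∫ w²(D_R^j L(Ψ))²`.
[cite: Elgindi2021, §7.3 proof of Proposition 7.7, Step 3, "L(D_R^kΨ) = D_R^kF" (p. 22 of arXiv:1904.04795)] -/
theorem polar_weighted_apriori_estimate_iterate {α : ℝ} (hα : 0 < α) (hα4 : α ≤ 1 / 4) (j : ℕ) :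
    ∀ {χ : ℝ → ℝ → ℝ}, ContDiff ℝ ((3 + j : ℕ) : WithTop ℕ∞) (uncurry χ) → HasCompactSupport (uncurry χ) →
      (∀ p ∈ tsupport (uncurry χ), 0 < p.1) → (∀ R, χ R 0 = 0) → ∀ {Ψ : ℝ → ℝ → ℝ}, (Ψ = fun R θ => Real.cos θ * χ R θ) →
      (∀ R, 0 < R → ∫ θ in Ioo 0 (π / 2), ellipticOp α Ψ R θ * kernelK θ = 0) →
    (∫ p in strip, radialWeight p.1 ^ 2 * dθ (Dz^[j] Ψ) p.1 p.2 ^ 2) ≤ ∫ p in strip, radialWeight p.1 ^ 2 * (Dz^[j] (ellipticOp α Ψ)) p.1 p.2 ^ 2 ∧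
    (∫ p in strip, radialWeight p.1 ^ 2 * (Dz^[j] Ψ) p.1 p.2 ^ 2) ≤ (1 / 12) * ∫ p in strip, radialWeight p.1 ^ 2 * (Dz^[j] (ellipticOp α Ψ)) p.1 p.2 ^ 2 ∧
    (∫ p in strip, radialWeight p.1 ^ 2 * dθ (dθ (Dz^[j] Ψ)) p.1 p.2 ^ 2) ≤ 12 * ∫ p in strip, radialWeight p.1 ^ 2 * (Dz^[j] (ellipticOp α Ψ)) p.1 p.2 ^ 2 ∧
    (∫ p in strip, radialWeight p.1 ^ 2 * dθ (Dz^[j] χ) p.1 p.2 ^ 2) ≤ 8 * ∫ p in strip, radialWeight p.1 ^ 2 * (Dz^[j] (ellipticOp α Ψ)) p.1 p.2 ^ 2 ∧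
    α ^ 2 * (∫ p in strip, radialWeight p.1 ^ 2 * (p.1 * dz (Dz^[j] Ψ) p.1 p.2) ^ 2) ≤ ∫ p in strip, radialWeight p.1 ^ 2 * (Dz^[j] (ellipticOp α Ψ)) p.1 p.2 ^ 2 ∧
    α ^ 4 * (∫ p in strip, radialWeight p.1 ^ 2 * (p.1 ^ 2 * dz (dz (Dz^[j] Ψ)) p.1 p.2) ^ 2) ≤
      372 * ∫ p in strip, radialWeight p.1 ^ 2 * (Dz^[j] (ellipticOp α Ψ)) p.1 p.2 ^ 2 ∧
    α ^ 2 * (∫ p in strip, radialWeight p.1 ^ 2 * (p.1 * dz (dθ (Dz^[j] Ψ)) p.1 p.2) ^ 2) ≤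
      12 * ∫ p in strip, radialWeight p.1 ^ 2 * (Dz^[j] (ellipticOp α Ψ)) p.1 p.2 ^ 2 ∧
    (∫ p in strip, radialWeight p.1 ^ 2 * (Dz^[j] χ) p.1 p.2 ^ 2) ≤ 2 * ∫ p in strip, radialWeight p.1 ^ 2 * (Dz^[j] (ellipticOp α Ψ)) p.1 p.2 ^ 2 := by
  induction j with
  | zero =>
    intro χ hχ hs hpos hχ0 Ψ hΨ horth
    simpa using polar_weighted_apriori_estimate hα hα4 (by simpa using hχ) hs hpos hχ0 hΨ horth
  | succ j ih =>
    intro χ hχ hs hpos hχ0 Ψ hΨ horth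
    have hχ4 : ContDiff ℝ 4 (uncurry χ) := hχ.of_le (by exact_mod_cast (show 4 ≤ 3 + (j + 1) by omega))
    have hχ3 : ContDiff ℝ 3 (uncurry χ) := hχ.of_le (by exact_mod_cast (show 3 ≤ 3 + (j + 1) by omega))
    have hχ1 : ContDiff ℝ 1 (uncurry χ) := hχ.of_le (by exact_mod_cast (show 1 ≤ 3 + (j + 1) by omega))
    have hΨ3 : ContDiff ℝ 3 (uncurry Ψ) := by rw [hΨ]; exact contDiff_cosProfile hχ3
    have hχ' : ContDiff ℝ ((3 + j : ℕ) : WithTop ℕ∞) (uncurry (Dz χ)) := by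
      refine contDiff_Dz_of_contDiff ?_
      have e : ((3 + (j + 1) : ℕ) : WithTop ℕ∞) = ((3 + j : ℕ) : WithTop ℕ∞) + 1 := by push_cast; ring
      rw [← e]; exact hχ
    have hs' : HasCompactSupport (uncurry (Dz χ)) := hasCompactSupport_Dz hs
    have hpos' : ∀ p ∈ tsupport (uncurry (Dz χ)), 0 < p.1 := tsupport_Dz_pos hpos
    have hχ0' : ∀ R, Dz χ R 0 = 0 := Dz_eq_zero_of_forall hχ0
    have hΨ' : Dz Ψ = fun R θ => Real.cos θ * Dz χ R θ := by rw [hΨ]; exact Dz_cosProfile hχ1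
    have horth' := ellipticOp_Dz_orthogonal (α := α) hχ4 hs hΨ horth
    have h := ih hχ' hs' hpos' hχ0' hΨ' horth'
    have eL : ∫ p in strip, radialWeight p.1 ^ 2 * (Dz^[j] (ellipticOp α (Dz Ψ))) p.1 p.2 ^ 2 =
        ∫ p in strip, radialWeight p.1 ^ 2 * (Dz^[j + 1] (ellipticOp α Ψ)) p.1 p.2 ^ 2 := by
      refine setIntegral_congr_fun measurableSet_strip fun p hp => ?_
      rw [iterate_Dz_congr (fun q hq => ellipticOp_Dz α hΨ3 hq) j p hp, ← Function.iterate_succ_apply]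
    simp only [← Function.iterate_succ_apply Dz j] at h
    rw [eL] at h
    exact h

/-- **Display (7.4) for all `k`** (`χ ∈ C^{3+k}`): the eight conclusions of
`polar_singular_apriori_estimate` for `D_R^kΨ`, with right-hand side `∫∫ w²u(D_R^k L(Ψ))²`
(`u = sin(2θ)^{−η}`). [cite: Elgindi2021, §7.3 proof of Proposition 7.7, Step 3, display (7.4) (p. 22 of arXiv:1904.04795)] -/
theorem polar_singular_apriori_estimate_iterate {α : ℝ} (hα : 0 < α) (hα4 : α ≤ 1 / 4) (j : ℕ) :
    ∀ {χ : ℝ → ℝ → ℝ}, ContDiff ℝ ((3 + j : ℕ) : WithTop ℕ∞) (uncurry χ) → HasCompactSupport (uncurry χ) →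
      (∀ p ∈ tsupport (uncurry χ), 0 < p.1) → (∀ R, χ R 0 = 0) → ∀ {Ψ : ℝ → ℝ → ℝ}, (Ψ = fun R θ => Real.cos θ * χ R θ) →
      (∀ R, 0 < R → ∫ θ in Ioo 0 (π / 2), ellipticOp α Ψ R θ * kernelK θ = 0) →
    (∫ p in strip, radialWeight p.1 ^ 2 * dθ (dθ (Dz^[j] Ψ)) p.1 p.2 ^ 2 * Real.sin (2 * p.2) ^ (-eta)) ≤
        42000 * ∫ p in strip, radialWeight p.1 ^ 2 * (Dz^[j] (ellipticOp α Ψ)) p.1 p.2 ^ 2 * Real.sin (2 * p.2) ^ (-eta) ∧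
    α ^ 2 * (∫ p in strip, p.1 ^ 2 * radialWeight p.1 ^ 2 * dz (dθ (Dz^[j] Ψ)) p.1 p.2 ^ 2 * Real.sin (2 * p.2) ^ (-eta)) ≤
        4200000 * ∫ p in strip, radialWeight p.1 ^ 2 * (Dz^[j] (ellipticOp α Ψ)) p.1 p.2 ^ 2 * Real.sin (2 * p.2) ^ (-eta) ∧
    (∫ p in strip, radialWeight p.1 ^ 2 * dθ (Dz^[j] χ) p.1 p.2 ^ 2 * Real.sin (2 * p.2) ^ (-eta)) ≤
        21000 * ∫ p in strip, radialWeight p.1 ^ 2 * (Dz^[j] (ellipticOp α Ψ)) p.1 p.2 ^ 2 * Real.sin (2 * p.2) ^ (-eta) ∧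
    α ^ 2 * (∫ p in strip, p.1 ^ 2 * radialWeight p.1 ^ 2 * dz (Dz^[j] Ψ) p.1 p.2 ^ 2 * Real.sin (2 * p.2) ^ (-eta)) ≤
        120 * ∫ p in strip, radialWeight p.1 ^ 2 * (Dz^[j] (ellipticOp α Ψ)) p.1 p.2 ^ 2 * Real.sin (2 * p.2) ^ (-eta) ∧
    (∫ p in strip, radialWeight p.1 ^ 2 * (Dz^[j] Ψ) p.1 p.2 ^ 2 * Real.sin (2 * p.2) ^ (-eta)) ≤
        10 * ∫ p in strip, radialWeight p.1 ^ 2 * (Dz^[j] (ellipticOp α Ψ)) p.1 p.2 ^ 2 * Real.sin (2 * p.2) ^ (-eta) ∧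
    (∫ p in strip, radialWeight p.1 ^ 2 * (Dz^[j] χ) p.1 p.2 ^ 2 * Real.sin (2 * p.2) ^ (-eta)) ≤
        4748 * ∫ p in strip, radialWeight p.1 ^ 2 * (Dz^[j] (ellipticOp α Ψ)) p.1 p.2 ^ 2 * Real.sin (2 * p.2) ^ (-eta) ∧
    (∫ p in strip, radialWeight p.1 ^ 2 * dθ (Dz^[j] Ψ) p.1 p.2 ^ 2 * Real.sin (2 * p.2) ^ (-eta)) ≤
        6322 * ∫ p in strip, radialWeight p.1 ^ 2 * (Dz^[j] (ellipticOp α Ψ)) p.1 p.2 ^ 2 * Real.sin (2 * p.2) ^ (-eta) ∧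
    α ^ 4 * (∫ p in strip, radialWeight p.1 ^ 2 * (p.1 ^ 2 * dz (dz (Dz^[j] Ψ)) p.1 p.2) ^ 2 * Real.sin (2 * p.2) ^ (-eta)) ≤
        440000 * ∫ p in strip, radialWeight p.1 ^ 2 * (Dz^[j] (ellipticOp α Ψ)) p.1 p.2 ^ 2 * Real.sin (2 * p.2) ^ (-eta) := by
  induction j with
  | zero =>
    intro χ hχ hs hpos hχ0 Ψ hΨ horth
    simpa using polar_singular_apriori_estimate hα hα4 (by simpa using hχ) hs hpos hχ0 hΨ horth
  | succ j ih =>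
    intro χ hχ hs hpos hχ0 Ψ hΨ horth
    have hχ4 : ContDiff ℝ 4 (uncurry χ) := hχ.of_le (by exact_mod_cast (show 4 ≤ 3 + (j + 1) by omega))
    have hχ3 : ContDiff ℝ 3 (uncurry χ) := hχ.of_le (by exact_mod_cast (show 3 ≤ 3 + (j + 1) by omega))
    have hχ1 : ContDiff ℝ 1 (uncurry χ) := hχ.of_le (by exact_mod_cast (show 1 ≤ 3 + (j + 1) by omega))
    have hΨ3 : ContDiff ℝ 3 (uncurry Ψ) := by rw [hΨ]; exact contDiff_cosProfile hχ3
    have hχ' : ContDiff ℝ ((3 + j : ℕ) : WithTop ℕ∞) (uncurry (Dz χ)) := by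
      refine contDiff_Dz_of_contDiff ?_
      have e : ((3 + (j + 1) : ℕ) : WithTop ℕ∞) = ((3 + j : ℕ) : WithTop ℕ∞) + 1 := by push_cast; ring
      rw [← e]; exact hχ
    have hs' : HasCompactSupport (uncurry (Dz χ)) := hasCompactSupport_Dz hs
    have hpos' : ∀ p ∈ tsupport (uncurry (Dz χ)), 0 < p.1 := tsupport_Dz_pos hpos
    have hχ0' : ∀ R, Dz χ R 0 = 0 := Dz_eq_zero_of_forall hχ0
    have hΨ' : Dz Ψ = fun R θ => Real.cos θ * Dz χ R θ := by rw [hΨ]; exact Dz_cosProfile hχ1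
    have horth' := ellipticOp_Dz_orthogonal (α := α) hχ4 hs hΨ horth
    have h := ih hχ' hs' hpos' hχ0' hΨ' horth'
    have eL : ∫ p in strip, radialWeight p.1 ^ 2 * (Dz^[j] (ellipticOp α (Dz Ψ))) p.1 p.2 ^ 2 * Real.sin (2 * p.2) ^ (-eta) =
        ∫ p in strip, radialWeight p.1 ^ 2 * (Dz^[j + 1] (ellipticOp α Ψ)) p.1 p.2 ^ 2 * Real.sin (2 * p.2) ^ (-eta) := by
      refine setIntegral_congr_fun measurableSet_strip fun p hp => ?_
      rw [iterate_Dz_congr (fun q hq => ellipticOp_Dz α hΨ3 hq) j p hp, ← Function.iterate_succ_apply]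
    simp only [← Function.iterate_succ_apply Dz j] at h
    rw [eL] at h
    exact h

end Elgindi

end Literature.Analysis.FluidPDE
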